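import Mathlib
import Literature.MathematicalPhysics.QuantumManyBody.BoseEinsteinCondensation
import Literature.MathematicalPhysics.QuantumManyBody.NeumannBoxParseval
import Summits.AtomisticToContinuum.BoseEinsteinCondensation.Theorems.SoloBlindInfraredBEC

/-!
# Positivity fixes the mode, not the mass: flat-mode dominance of one-particle occupations

Solo seat `solo-AtomisticToContinuum-blind`, conjunct `BoseEinsteinCondensation` (kernel K18).

For an `(n+1)`-boson Dirichlet trial state `Ψ` on the box `Λ_L = (0,L)³` and a one-particle mode
`φ` bounded by `B` on the box, the elementary pointwise estimate
`|⟨φ, Ψ(·,Y)⟩| ≤ B ∫ |Ψ(x,Y)| dx = B L^{3/2} ⟨u_0, |Ψ|(·,Y)⟩` (`u_0 = L^{-3/2}` the flat Neumann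
mode) gives, after squaring and integrating over the other particles `Y`,

* `occupation_le_flat_abs` : `n_φ(Ψ) ≤ B² L³ · N_0(|Ψ|)` — the occupation of ANY bounded mode is
  controlled by the flat-mode occupation of `|Ψ|` ("diamagnetic" form, valid for every `Ψ`;
  `N_0` in the slice form of `SoloBlindModeOccupation` / `SoloBlindInfraredBEC`);
* `modeOccupation_le_flat_abs` : for the Neumann cosine modes `u_k`, `k ∈ ℕ₀³`,
  `N_k(Ψ) ≤ (∏ᵢ c_{kᵢ})² N_0(|Ψ|) ≤ 8 N_0(|Ψ|)` (`c_0 = 1`, `c_m = √2`; the constant is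
  `2^{#{i : kᵢ ≠ 0}}`, `prod_cosCoeff_sq_eq`);
* for NONNEGATIVE states (`Ψ = |Ψ|`, e.g. the Dirichlet ground state of a repulsive pair
  potential): `occupation_le_flat_of_nonneg` (`n_φ(Ψ) ≤ B²L³ N_0(Ψ)`),
  `occupation_le_maxOccupation_of_nonneg` and `modeOccupation_le_eight_mul_zero_of_nonneg`
  (`N_k(Ψ) ≤ 8 N_0(Ψ)` for every `k`).

Reading: in a positive state no delocalised mode (`‖φ‖²_∞ ≲ 1/L³`) can be more occupied than a
constant times the flat mode, so "which mode carries the condensate" is never the issue for the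
ground state; what positivity does NOT control is the total occupation of the many low modes
(fragmented nonnegative states exist in every energy window, `SoloBlindFragmentedStates`,
`SoloBlindCentreOfMass`).  Torus analogue (translation invariance): `n_p ≤ n_0` for all `p`.
-/

noncomputable section

open MeasureTheory Filter Set
open scoped ENNReal NNReal Real ComplexConjugate

namespace Summit.AtomisticToContinuum.BoseEinsteinCondensation.Theorems

open Literature.MathematicalPhysics.QuantumManyBody.BoseGas
open Literature.MathematicalPhysics.QuantumManyBody.NeumannBox

/-! ### Constants of the Neumann modes -/

/-- `|e_m(t)| ≤ c_m/√ℓ` (sharper than `√(2/ℓ)` for the flat factor `m = 0`). -/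
theorem abs_cosMode_le_cosCoeff_div {ℓ : ℝ} (hℓ : 0 < ℓ) (m : ℕ) (t : ℝ) :
    |cosMode ℓ m t| ≤ cosCoeff m / Real.sqrt ℓ := by
  unfold cosMode
  rw [abs_mul, abs_div, abs_of_pos (cosCoeff_pos m), abs_of_pos (Real.sqrt_pos.2 hℓ)]
  exact mul_le_of_le_one_right (div_nonneg (cosCoeff_pos m).le (Real.sqrt_nonneg _))
    (Real.abs_cos_le_one _)

/-- `|u_k(x)| ≤ (∏ᵢ c_{kᵢ}) · L^{-3/2}`. -/
theorem abs_mode_le {L : ℝ} (hL : 0 < L) (k : Fin 3 → ℕ) (x : Space) :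
    |mode L k x| ≤ (∏ i, cosCoeff (k i)) * (1 / Real.sqrt L) ^ 3 := by
  unfold mode
  rw [Finset.abs_prod]
  calc ∏ i, |cosMode L (k i) (x i)| ≤ ∏ i, cosCoeff (k i) / Real.sqrt L :=
        Finset.prod_le_prod (fun i _ => abs_nonneg _) fun i _ => abs_cosMode_le_cosCoeff_div hL _ _
    _ = (∏ i, cosCoeff (k i)) * (1 / Real.sqrt L) ^ 3 := by
        rw [Finset.prod_div_distrib, Finset.prod_const, Finset.card_univ, Fintype.card_fin,
          div_eq_mul_one_div, one_div_pow]

/-- `(∏ᵢ c_{kᵢ})² = ∏ᵢ (1 or 2) = 2^{#{i : kᵢ ≠ 0}}`. -/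
theorem prod_cosCoeff_sq_eq (k : Fin 3 → ℕ) :
    (∏ i, cosCoeff (k i)) ^ 2 = ∏ i, (if k i = 0 then (1 : ℝ) else 2) := by
  rw [← Finset.prod_pow]
  exact Finset.prod_congr rfl fun i _ => cosCoeff_sq (k i)

/-- `(∏ᵢ c_{kᵢ})² ≤ 8`. -/
theorem prod_cosCoeff_sq_le_eight (k : Fin 3 → ℕ) : (∏ i, cosCoeff (k i)) ^ 2 ≤ 8 := by
  rw [prod_cosCoeff_sq_eq]
  calc ∏ i, (if k i = 0 then (1 : ℝ) else 2) ≤ ∏ _i : Fin 3, (2 : ℝ) :=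
        Finset.prod_le_prod (fun i _ => by split_ifs <;> norm_num)
          fun i _ => by split_ifs <;> norm_num
    _ = 8 := by norm_num

/-- Squaring a norm comparison, in `ℝ≥0∞`. -/
theorem sq_enorm_le_of_norm_le {a b : ℂ} {t : ℝ} (h : ‖a‖ ≤ t * ‖b‖) :
    ‖a‖ₑ ^ 2 ≤ ENNReal.ofReal (t ^ 2) * ‖b‖ₑ ^ 2 := by
  have h2 : ‖a‖ ^ 2 ≤ t ^ 2 * ‖b‖ ^ 2 := by
    rw [← mul_pow]
    exact pow_le_pow_left₀ (norm_nonneg _) h 2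
  rw [← ofReal_norm, ← ofReal_norm, ← ENNReal.ofReal_pow (norm_nonneg _),
    ← ENNReal.ofReal_pow (norm_nonneg _), ← ENNReal.ofReal_mul (sq_nonneg _)]
  exact ENNReal.ofReal_le_ofReal h2

/-! ### Slices of a trial state -/

section Slices

variable {n : ℕ} {L : ℝ}

/-- A slice `x ↦ Ψ(x, Y)` vanishes off the one-particle box. -/
private theorem soloFlat_slice_eq_zero (Ψ : TrialState (n + 1) L) (Y : Config n) {x : Space}
    (hx : x ∉ box L) : Ψ.ψ (Matrix.vecCons x Y) = 0 :=
  Ψ.eq_zero _ fun h => hx (by simpa using h 0)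

/-- A slice `x ↦ Ψ(x, Y)` has compact support (inside the closed box). -/
private theorem soloFlat_hasCompactSupport_slice (Ψ : TrialState (n + 1) L) (Y : Config n) :
    HasCompactSupport fun x : Space => Ψ.ψ (Matrix.vecCons x Y) := by
  set e := PiLp.continuousLinearEquiv 2 ℝ (fun _ : Fin 3 => ℝ) with he
  have hK : IsCompact (e.symm '' Set.pi univ fun _ : Fin 3 => Set.Icc (0 : ℝ) L) :=
    (isCompact_univ_pi fun _ => isCompact_Icc).image e.symm.continuous
  refine HasCompactSupport.intro hK fun x hx => ?_
  by_contra hne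
  apply hx
  have hxbox : x ∈ box L := by
    by_contra hxb
    exact hne (soloFlat_slice_eq_zero Ψ Y hxb)
  rw [box_eq_preimage] at hxbox
  exact ⟨e x, Set.pi_mono (fun _ _ => Set.Ioo_subset_Icc_self) hxbox, e.symm_apply_apply x⟩

/-- A slice `x ↦ Ψ(x, Y)` is integrable. -/
private theorem soloFlat_integrable_slice (Ψ : TrialState (n + 1) L) (Y : Config n) :
    Integrable fun x : Space => Ψ.ψ (Matrix.vecCons x Y) :=
  (contDiff_slice Ψ Y).continuous.integrable_of_hasCompactSupport
    (soloFlat_hasCompactSupport_slice Ψ Y)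

/-- The box is measurable. -/
private theorem soloFlat_measurableSet_box (L : ℝ) : MeasurableSet (box L) := by
  rw [box_eq_preimage]
  exact (MeasurableSet.univ_pi fun _ => measurableSet_Ioo).preimage
    (PiLp.volume_preserving_ofLp (Fin 3)).measurable

/-- `∫ |Ψ(x,Y)| dx` over space equals the integral over the box. -/
theorem integral_norm_slice_eq_setIntegral (Ψ : TrialState (n + 1) L) (Y : Config n) :
    ∫ x, ‖Ψ.ψ (Matrix.vecCons x Y)‖ = ∫ x in box L, ‖Ψ.ψ (Matrix.vecCons x Y)‖ :=
  (setIntegral_eq_integral_of_forall_compl_eq_zero fun x hx => by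
    rw [soloFlat_slice_eq_zero Ψ Y hx, norm_zero]).symm

/-! ### The pointwise (fixed `Y`) estimates -/

/-- **Core estimate.** For a mode bounded by `B` on the box,
`|⟨φ, Ψ(·,Y)⟩| ≤ B ∫_{Λ_L} |Ψ(x,Y)| dx`. -/
theorem norm_integral_conj_mul_slice_le (Ψ : TrialState (n + 1) L) (Y : Config n)
    {φ : Space → ℂ} {B : ℝ} (hφ : ∀ x ∈ box L, ‖φ x‖ ≤ B) :
    ‖∫ x, conj (φ x) * Ψ.ψ (Matrix.vecCons x Y)‖ ≤
      B * ∫ x in box L, ‖Ψ.ψ (Matrix.vecCons x Y)‖ := by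
  rw [← integral_norm_slice_eq_setIntegral]
  calc ‖∫ x, conj (φ x) * Ψ.ψ (Matrix.vecCons x Y)‖
      ≤ ∫ x, ‖conj (φ x) * Ψ.ψ (Matrix.vecCons x Y)‖ := norm_integral_le_integral_norm _
    _ ≤ ∫ x, B * ‖Ψ.ψ (Matrix.vecCons x Y)‖ := by
        refine integral_mono_of_nonneg (Eventually.of_forall fun x => norm_nonneg _)
          ((soloFlat_integrable_slice Ψ Y).norm.const_mul B) (Eventually.of_forall fun x => ?_)
        change ‖conj (φ x) * Ψ.ψ (Matrix.vecCons x Y)‖ ≤ B * ‖Ψ.ψ (Matrix.vecCons x Y)‖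
        rw [norm_mul, RCLike.norm_conj]
        by_cases hx : x ∈ box L
        · exact mul_le_mul_of_nonneg_right (hφ x hx) (norm_nonneg _)
        · rw [soloFlat_slice_eq_zero Ψ Y hx, norm_zero, mul_zero, mul_zero]
    _ = B * ∫ x, ‖Ψ.ψ (Matrix.vecCons x Y)‖ := integral_const_mul _ _

/-- The flat-mode coefficient of `|Ψ|(·, Y)`: `⟨u_0, |Ψ|(·,Y)⟩ = L^{-3/2} ∫_{Λ_L} |Ψ(x,Y)| dx`. -/
theorem flatCoeff_abs_eq (Ψ : TrialState (n + 1) L) (Y : Config n) :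
    ∫ x in box L, (mode L 0 x : ℂ) * (‖Ψ.ψ (Matrix.vecCons x Y)‖ : ℂ) =
      (((1 / Real.sqrt L) ^ 3 * ∫ x in box L, ‖Ψ.ψ (Matrix.vecCons x Y)‖ : ℝ) : ℂ) := by
  rw [setIntegral_congr_fun (soloFlat_measurableSet_box L) (fun x _ => by rw [mode_zero]),
    integral_const_mul, integral_complex_ofReal, Complex.ofReal_mul]

/-- Its norm: `|⟨u_0, |Ψ|(·,Y)⟩| = L^{-3/2} ∫_{Λ_L} |Ψ(x,Y)| dx`. -/
theorem norm_flatCoeff_abs_eq (Ψ : TrialState (n + 1) L) (Y : Config n) :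
    ‖∫ x in box L, (mode L 0 x : ℂ) * (‖Ψ.ψ (Matrix.vecCons x Y)‖ : ℂ)‖ =
      (1 / Real.sqrt L) ^ 3 * ∫ x in box L, ‖Ψ.ψ (Matrix.vecCons x Y)‖ := by
  rw [flatCoeff_abs_eq, Complex.norm_real, Real.norm_of_nonneg]
  exact mul_nonneg (by positivity) (integral_nonneg fun x => norm_nonneg _)

/-- **Pointwise flat-mode dominance**: `|⟨φ, Ψ(·,Y)⟩| ≤ B L^{3/2} · |⟨u_0, |Ψ|(·,Y)⟩|`. -/
theorem norm_integral_conj_mul_slice_le_flat (hL : 0 < L) (Ψ : TrialState (n + 1) L)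
    (Y : Config n) {φ : Space → ℂ} {B : ℝ} (hφ : ∀ x ∈ box L, ‖φ x‖ ≤ B) :
    ‖∫ x, conj (φ x) * Ψ.ψ (Matrix.vecCons x Y)‖ ≤
      (B * Real.sqrt L ^ 3) *
        ‖∫ x in box L, (mode L 0 x : ℂ) * (‖Ψ.ψ (Matrix.vecCons x Y)‖ : ℂ)‖ := by
  rw [norm_flatCoeff_abs_eq]
  have hs : Real.sqrt L ^ 3 * (1 / Real.sqrt L) ^ 3 = 1 := by
    rw [← mul_pow, mul_one_div_cancel (Real.sqrt_pos.2 hL).ne', one_pow]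
  calc ‖∫ x, conj (φ x) * Ψ.ψ (Matrix.vecCons x Y)‖
      ≤ B * ∫ x in box L, ‖Ψ.ψ (Matrix.vecCons x Y)‖ := norm_integral_conj_mul_slice_le Ψ Y hφ
    _ = (B * Real.sqrt L ^ 3) *
          ((1 / Real.sqrt L) ^ 3 * ∫ x in box L, ‖Ψ.ψ (Matrix.vecCons x Y)‖) := by
        rw [← mul_assoc, mul_assoc B, hs, mul_one]

/-- **Pointwise Neumann-mode dominance**: `|⟨u_k, Ψ(·,Y)⟩| ≤ (∏ᵢ c_{kᵢ}) · |⟨u_0, |Ψ|(·,Y)⟩|`. -/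
theorem norm_modeCoeff_le_flat_abs (hL : 0 < L) (Ψ : TrialState (n + 1) L) (Y : Config n)
    (k : Fin 3 → ℕ) :
    ‖∫ x in box L, (mode L k x : ℂ) * Ψ.ψ (Matrix.vecCons x Y)‖ ≤
      (∏ i, cosCoeff (k i)) *
        ‖∫ x in box L, (mode L 0 x : ℂ) * (‖Ψ.ψ (Matrix.vecCons x Y)‖ : ℂ)‖ := by
  rw [norm_flatCoeff_abs_eq]
  set P : ℝ := ∏ i, cosCoeff (k i) with hP
  set c : ℝ := (1 / Real.sqrt L) ^ 3 with hc
  calc ‖∫ x in box L, (mode L k x : ℂ) * Ψ.ψ (Matrix.vecCons x Y)‖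
      ≤ ∫ x in box L, ‖(mode L k x : ℂ) * Ψ.ψ (Matrix.vecCons x Y)‖ :=
        norm_integral_le_integral_norm _
    _ ≤ ∫ x in box L, (P * c) * ‖Ψ.ψ (Matrix.vecCons x Y)‖ := by
        refine integral_mono_of_nonneg (Eventually.of_forall fun x => norm_nonneg _)
          (((soloFlat_integrable_slice Ψ Y).norm.const_mul (P * c)).integrableOn)
          (Eventually.of_forall fun x => ?_)
        change ‖(mode L k x : ℂ) * Ψ.ψ (Matrix.vecCons x Y)‖ ≤ (P * c) * ‖Ψ.ψ (Matrix.vecCons x Y)‖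
        rw [norm_mul, Complex.norm_real, Real.norm_eq_abs]
        exact mul_le_mul_of_nonneg_right (abs_mode_le hL k x) (norm_nonneg _)
    _ = P * (c * ∫ x in box L, ‖Ψ.ψ (Matrix.vecCons x Y)‖) := by
        rw [integral_const_mul, mul_assoc]

/-! ### Occupations -/

/-- **Flat-mode dominance (diamagnetic form, every trial state).** For a mode `φ` with
`|φ| ≤ B` on the box: `n_φ(Ψ) ≤ B² L³ · N_0(|Ψ|)`, where
`N_0(|Ψ|) = (n+1) ∫ |⟨u_0, |Ψ|(·,Y)⟩|² dY` is the flat-mode occupation of `|Ψ|`. -/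
theorem occupation_le_flat_abs (hL : 0 < L) (Ψ : TrialState (n + 1) L)
    {φ : Space → ℂ} {B : ℝ} (hφ : ∀ x ∈ box L, ‖φ x‖ ≤ B) :
    occupation (n + 1) φ Ψ.ψ ≤
      ENNReal.ofReal (B ^ 2 * L ^ 3) * ((n + 1 : ℝ≥0∞) * ∫⁻ Y : Config n,
        ‖∫ x in box L, (mode L 0 x : ℂ) * (‖Ψ.ψ (Matrix.vecCons x Y)‖ : ℂ)‖ₑ ^ 2) := by
  simp only [occupation, ← enorm_eq_nnnorm]
  have ht2 : (B * Real.sqrt L ^ 3) ^ 2 = B ^ 2 * L ^ 3 := by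
    rw [mul_pow, ← pow_mul, show 3 * 2 = 2 * 3 by norm_num, pow_mul, Real.sq_sqrt hL.le]
  have hpt : ∀ Y : Config n,
      ‖∫ x, conj (φ x) * Ψ.ψ (Matrix.vecCons x Y)‖ₑ ^ 2 ≤
        ENNReal.ofReal (B ^ 2 * L ^ 3) *
          ‖∫ x in box L, (mode L 0 x : ℂ) * (‖Ψ.ψ (Matrix.vecCons x Y)‖ : ℂ)‖ₑ ^ 2 :=
    fun Y => by
      rw [← ht2]
      exact sq_enorm_le_of_norm_le (norm_integral_conj_mul_slice_le_flat hL Ψ Y hφ)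
  calc (n + 1 : ℝ≥0∞) * ∫⁻ Y, ‖∫ x, conj (φ x) * Ψ.ψ (Matrix.vecCons x Y)‖ₑ ^ 2
      ≤ (n + 1 : ℝ≥0∞) * ∫⁻ Y, ENNReal.ofReal (B ^ 2 * L ^ 3) *
          ‖∫ x in box L, (mode L 0 x : ℂ) * (‖Ψ.ψ (Matrix.vecCons x Y)‖ : ℂ)‖ₑ ^ 2 :=
        mul_le_mul_of_nonneg_left (lintegral_mono hpt) zero_le
    _ = ENNReal.ofReal (B ^ 2 * L ^ 3) * ((n + 1 : ℝ≥0∞) * ∫⁻ Y,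
          ‖∫ x in box L, (mode L 0 x : ℂ) * (‖Ψ.ψ (Matrix.vecCons x Y)‖ : ℂ)‖ₑ ^ 2) := by
        rw [lintegral_const_mul' _ _ ENNReal.ofReal_ne_top]
        ring

/-- **Neumann modes: `N_k(Ψ) ≤ (∏ᵢ c_{kᵢ})² N_0(|Ψ|)`** (slice form), for every trial state. -/
theorem modeOccupation_le_flat_abs (hL : 0 < L) (Ψ : TrialState (n + 1) L) (k : Fin 3 → ℕ) :
    (n + 1 : ℝ≥0∞) * ∫⁻ Y : Config n,
        ‖∫ x in box L, (mode L k x : ℂ) * Ψ.ψ (Matrix.vecCons x Y)‖ₑ ^ 2 ≤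
      ENNReal.ofReal ((∏ i, cosCoeff (k i)) ^ 2) * ((n + 1 : ℝ≥0∞) * ∫⁻ Y : Config n,
        ‖∫ x in box L, (mode L 0 x : ℂ) * (‖Ψ.ψ (Matrix.vecCons x Y)‖ : ℂ)‖ₑ ^ 2) := by
  have hsq : ∀ Y : Config n,
      ‖∫ x in box L, (mode L k x : ℂ) * Ψ.ψ (Matrix.vecCons x Y)‖ₑ ^ 2 ≤
        ENNReal.ofReal ((∏ i, cosCoeff (k i)) ^ 2) *
          ‖∫ x in box L, (mode L 0 x : ℂ) * (‖Ψ.ψ (Matrix.vecCons x Y)‖ : ℂ)‖ₑ ^ 2 :=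
    fun Y => sq_enorm_le_of_norm_le (norm_modeCoeff_le_flat_abs hL Ψ Y k)
  calc (n + 1 : ℝ≥0∞) * ∫⁻ Y : Config n,
        ‖∫ x in box L, (mode L k x : ℂ) * Ψ.ψ (Matrix.vecCons x Y)‖ₑ ^ 2
      ≤ (n + 1 : ℝ≥0∞) * ∫⁻ Y : Config n, ENNReal.ofReal ((∏ i, cosCoeff (k i)) ^ 2) *
          ‖∫ x in box L, (mode L 0 x : ℂ) * (‖Ψ.ψ (Matrix.vecCons x Y)‖ : ℂ)‖ₑ ^ 2 :=
        mul_le_mul_of_nonneg_left (lintegral_mono hsq) zero_le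
    _ = ENNReal.ofReal ((∏ i, cosCoeff (k i)) ^ 2) * ((n + 1 : ℝ≥0∞) * ∫⁻ Y : Config n,
          ‖∫ x in box L, (mode L 0 x : ℂ) * (‖Ψ.ψ (Matrix.vecCons x Y)‖ : ℂ)‖ₑ ^ 2) := by
        rw [lintegral_const_mul' _ _ ENNReal.ofReal_ne_top]
        ring

/-- **`N_k(Ψ) ≤ 8 N_0(|Ψ|)`** for every Neumann mode `k` and every trial state. -/
theorem modeOccupation_le_eight_mul_flat_abs (hL : 0 < L) (Ψ : TrialState (n + 1) L)
    (k : Fin 3 → ℕ) :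
    (n + 1 : ℝ≥0∞) * ∫⁻ Y : Config n,
        ‖∫ x in box L, (mode L k x : ℂ) * Ψ.ψ (Matrix.vecCons x Y)‖ₑ ^ 2 ≤
      8 * ((n + 1 : ℝ≥0∞) * ∫⁻ Y : Config n,
        ‖∫ x in box L, (mode L 0 x : ℂ) * (‖Ψ.ψ (Matrix.vecCons x Y)‖ : ℂ)‖ₑ ^ 2) := by
  refine (modeOccupation_le_flat_abs hL Ψ k).trans (mul_le_mul_of_nonneg_right ?_ zero_le)
  calc ENNReal.ofReal ((∏ i, cosCoeff (k i)) ^ 2) ≤ ENNReal.ofReal 8 :=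
        ENNReal.ofReal_le_ofReal (prod_cosCoeff_sq_le_eight k)
    _ = 8 := by norm_num

/-! ### Nonnegative states -/

/-- **Flat-mode dominance for nonnegative states**: if `Ψ ≥ 0` and `|φ| ≤ B` on the box, then
`n_φ(Ψ) ≤ B² L³ · N_0(Ψ)`. -/
theorem occupation_le_flat_of_nonneg (hL : 0 < L) (Ψ : TrialState (n + 1) L)
    (hpos : ∀ X, (‖Ψ.ψ X‖ : ℂ) = Ψ.ψ X) {φ : Space → ℂ} {B : ℝ}
    (hφ : ∀ x ∈ box L, ‖φ x‖ ≤ B) :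
    occupation (n + 1) φ Ψ.ψ ≤
      ENNReal.ofReal (B ^ 2 * L ^ 3) * ((n + 1 : ℝ≥0∞) * ∫⁻ Y : Config n,
        ‖∫ x in box L, (mode L 0 x : ℂ) * Ψ.ψ (Matrix.vecCons x Y)‖ₑ ^ 2) := by
  have h := occupation_le_flat_abs hL Ψ hφ
  simp_rw [hpos] at h
  exact h

/-- **Consequently `n_φ(Ψ) ≤ B² L³ · λ_max(γ_Ψ)` with the flat mode as witness**: for a
nonnegative state, macroscopic occupation of any delocalised mode (`B² L³ = K²` fixed) forces
flat-mode occupation `≥ n_φ / K²` (combine `occupation_le_flat_of_nonneg` with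
`modeOccupation_zero_le_maxOccupation`). -/
theorem occupation_le_maxOccupation_of_nonneg (hL : 0 < L) (Ψ : TrialState (n + 1) L)
    (hpos : ∀ X, (‖Ψ.ψ X‖ : ℂ) = Ψ.ψ X) {φ : Space → ℂ} {B : ℝ}
    (hφ : ∀ x ∈ box L, ‖φ x‖ ≤ B) :
    occupation (n + 1) φ Ψ.ψ ≤ ENNReal.ofReal (B ^ 2 * L ^ 3) * maxOccupation (n + 1) Ψ.ψ :=
  (occupation_le_flat_of_nonneg hL Ψ hpos hφ).trans
    (mul_le_mul_of_nonneg_left (modeOccupation_zero_le_maxOccupation hL Ψ) zero_le)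

/-- **`N_k(Ψ) ≤ 8 N_0(Ψ)` for nonnegative states**: in a positive state no Neumann mode is more
than eight times as occupied as the flat mode. -/
theorem modeOccupation_le_eight_mul_zero_of_nonneg (hL : 0 < L) (Ψ : TrialState (n + 1) L)
    (hpos : ∀ X, (‖Ψ.ψ X‖ : ℂ) = Ψ.ψ X) (k : Fin 3 → ℕ) :
    (n + 1 : ℝ≥0∞) * ∫⁻ Y : Config n,
        ‖∫ x in box L, (mode L k x : ℂ) * Ψ.ψ (Matrix.vecCons x Y)‖ₑ ^ 2 ≤
      8 * ((n + 1 : ℝ≥0∞) * ∫⁻ Y : Config n,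
        ‖∫ x in box L, (mode L 0 x : ℂ) * Ψ.ψ (Matrix.vecCons x Y)‖ₑ ^ 2) := by
  have h := modeOccupation_le_eight_mul_flat_abs hL Ψ k
  simp_rw [hpos] at h
  exact h

/-- The same with the sharp constant `(∏ᵢ c_{kᵢ})² = 2^{#{i : kᵢ ≠ 0}}`:
`N_k(Ψ) ≤ (∏ᵢ c_{kᵢ})² N_0(Ψ)` for nonnegative states. -/
theorem modeOccupation_le_prod_sq_mul_zero_of_nonneg (hL : 0 < L) (Ψ : TrialState (n + 1) L)
    (hpos : ∀ X, (‖Ψ.ψ X‖ : ℂ) = Ψ.ψ X) (k : Fin 3 → ℕ) :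
    (n + 1 : ℝ≥0∞) * ∫⁻ Y : Config n,
        ‖∫ x in box L, (mode L k x : ℂ) * Ψ.ψ (Matrix.vecCons x Y)‖ₑ ^ 2 ≤
      ENNReal.ofReal ((∏ i, cosCoeff (k i)) ^ 2) * ((n + 1 : ℝ≥0∞) * ∫⁻ Y : Config n,
        ‖∫ x in box L, (mode L 0 x : ℂ) * Ψ.ψ (Matrix.vecCons x Y)‖ₑ ^ 2) := by
  have h := modeOccupation_le_flat_abs hL Ψ k
  simp_rw [hpos] at h
  exact h

end Slices

end Summit.AtomisticToContinuum.BoseEinsteinCondensation.Theorems
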